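import Summits.NavierStokesRegularity.FunctionalMining.TopEigGapCoerciveFloor
import Summits.NavierStokesRegularity.FunctionalMining.TopEigColumnChargeLow
import HarnessLib

/-!
# FunctionalMining — Proposition L-λ(η) below `q = 2` on the AMPLITUDE-FLOOR part of the top-gap class,
# the WHOLE BRICK RANGE `6/5 ≤ q ≤ 2` (sequel of `TopEigGapCoerciveFloor`: the `q ≥ 5/3` restriction of
# N14b removed by `TopEigColumnChargeLow`)

Search for candidate a priori estimates; no regularity claim. Cell `pub-nsfunc`, prove seat (gen 29);
the (LL) programme below `2` of the prove seat's DERIVATIVES §51. `TopEigGapCoerciveFloor.lean` proves the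
node `topEigHeatCoerciveOn_gap_floor` for `5/3 ≤ q ≤ 2`; the only place where `q ≥ 5/3` enters is the
heat side, N14b with constant `2q/3` (`heatDissipation_topEigMoment_ge_integral_column`). With the uniform
constant `q·min(q−1, 2/3)` of `TopEigColumnChargeLow.heatDissipation_topEigMoment_ge_integral_column_min`
(every real `q ≥ 1`) the same five-line chain gives:

* **`topEigMoment_rpow_le_heatDissipation_of_simple_gap_min`** — for every real `q > 1`, `0 < η ≤ 1`,
  `v` smooth divergence free with `λ₂ < λ₁` and `λ₂ ≤ (1−η)λ₁` everywhere, and `∫‖v‖²λ₁^{q−2} ≤ KΦ_q(v)`: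
  `(q·min(q−1,2/3) / (3c₁(K+1)))·Φ_q(v) ≤ T_q(v)`, `c₁ = 2((q−2)² + 2/η²)` (for `q ≥ 5/3` this is the
  constant `2q/(9c₁(K+1))` of `TopEigGapCoerciveFloor`);
* **`topEigHeatCoerciveOn_gap_floor_low`** — THE NODE ON THE FLOOR CLASS FOR `6/5 ≤ q ≤ 2`: for
  `0 < η ≤ 1`, `κ > 0` there is `c > 0` with `c·Φ_q(v) ≤ T_q(v)` for every smooth divergence-free
  zero-mean `v` with `λ₂ ≤ (1−η)λ₁` and `κΦ_q(v)^{1/q} ≤ λ₁` everywhere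
  (`c = q·min(q−1,2/3)/(3c₁(K₀κ^{q−2}+1))`, `K₀` the brick constant of
  `exists_integral_norm_sq_mul_topEig_rpow_le_of_floor`, whose range `6/5 ≤ q ≤ 2` is now the only
  restriction); **`topEigHeatCoerciveOn_gap_floor_low'`** — every `η > 0`.

READING (unchanged from `TopEigGapCoerciveFloor`): on the floor class the rate degenerates like
`(q−1)κ^{2−q}`; a violating sequence for the gap-class node below `2`, if any, has `min λ₁/‖λ₁‖_q → 0`.
NOT CLAIMED: the node without floor, `q < 6/5` (the Sobolev–Poincaré brick at `(s,r) = (q,2)` needs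
`1/q − 1/3 ≤ 1/2`), constants, the one-sided node, Navier–Stokes regularity. [ours]
FILING (prove seat g33, ROW FloorLow, LEAD (cccccccc) INBOX l.5657 (ii), queued (59g) l.5806 / (59m) l.5827): = staged `pub-nsfunc-prove/staged/g29-own/TopEigGapCoerciveFloorLow.lean` 648a47afe3affb7d; this line is the only addition.
-/

noncomputable section

open Filter Topology Matrix Finset MeasureTheory
open scoped ContDiff

namespace Summit.NavierStokesRegularity.FunctionalMining

open Literature.Analysis Literature.Analysis.FunctionSpaces Literature.Analysis.FunctionSpaces.Torus
  SharpClass.DirectorForm Literature.Analysis.Matrix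

namespace TopEig

open StrainL4 StrainTensor

variable {v : UnitAddTorus (Fin 3) → EuclideanSpace ℝ (Fin 3)}

/-! ## 1. The moment estimate on everywhere-simple fields of the top-gap class, every real `q > 1` -/

/-- **THE MOMENT ESTIMATE ON EVERYWHERE-SIMPLE FIELDS OF THE TOP-GAP CLASS, every real `q > 1`.** For `v`
smooth and divergence free on `T³` with `λ₂ < λ₁` and `λ₂ ≤ (1−η)λ₁` at every point (`0 < η ≤ 1`), and every
`K ≥ 0` with `∫‖v‖²λ₁^{q−2} ≤ K·Φ_q(v)`:
`(q·min(q−1,2/3) / (3·c₁·(K+1)))·Φ_q(v) ≤ T_q(v)`, `c₁ = 2((q−2)² + 2/η²)`. Same chain as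
`topEigMoment_rpow_le_heatDissipation_of_simple_gap` with N14b's uniform constant. [ours] -/
theorem topEigMoment_rpow_le_heatDissipation_of_simple_gap_min (hv : Torus.IsSmooth v)
    (hdiv : Torus.IsDivFree v) {q : ℝ} (hq : 1 < q) {η : ℝ} (hη0 : 0 < η) (hη1 : η ≤ 1)
    (hsimple : ∀ x : UnitAddTorus (Fin 3), torusStrainMidEig v x < torusStrainTopEig v x)
    (hgap : ∀ x : UnitAddTorus (Fin 3), torusStrainMidEig v x ≤ (1 - η) * torusStrainTopEig v x)
    {K : ℝ} (hK0 : 0 ≤ K) (hK : ∫ x, ‖v x‖ ^ 2 * torusStrainTopEig v x ^ (q - 2) ≤ K * torusTopEigMoment q v) :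
    q * min (q - 1) (2 / 3) / (3 * (2 * ((q - 2) ^ 2 + 2 / η ^ 2)) * (K + 1)) * torusTopEigMoment q v ≤
      heatDissipation (torusTopEigMoment q) v := by
  have hq1 : (1 : ℝ) ≤ q := hq.le
  have hq0 : 0 < q := by linarith
  set m : ℝ := min (q - 1) (2 / 3) with hmdef
  have hm0 : 0 < m := lt_min (by linarith) (by norm_num)
  have hlpos : ∀ x, 0 < torusStrainTopEig v x := fun x => topEig_pos_of_simple hv hdiv (hsimple x)
  have hl0 : ∀ x, 0 ≤ torusStrainTopEig v x := fun x => (hlpos x).le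
  -- smoothness of `λ₁` and of the multiplier
  have hgf : ∀ x : UnitAddTorus (Fin 3), ∃ (e : Fin 3 → ℝ) (lam g : ℝ), e ⬝ᵥ e = 1 ∧
      torusStrainMatrix v x *ᵥ e = lam • e ∧ 0 < g ∧
      ∀ w, w ⬝ᵥ e = 0 → w ⬝ᵥ torusStrainMatrix v x *ᵥ w ≤ (lam - g) * (w ⬝ᵥ w) := fun x => by
    obtain ⟨e, he1, hSe, hg, hgap'⟩ := exists_gapForm_of_midEig_lt_topEig (hsimple x)
    exact ⟨e, _, _, he1, hSe, hg, hgap'⟩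
  have hls : Torus.IsSmooth (torusStrainTopEig v) := isSmooth_torusStrainTopEig_of_simple hv hgf
  have hlc : Continuous (torusStrainTopEig v) := hls.continuous
  have hLc : Continuous fun x => torusStrainTopEig v x ^ (q - 2) :=
    hlc.rpow_const fun x => Or.inl (hlpos x).ne'
  have hMs : ∀ i j, Torus.IsSmooth
      (fun y => torusStrainTopEig v y ^ (q - 2) * (torusStrainTopEig v y * topProj v y i j)) :=
    fun i j => isSmooth_powProj_entry hv hdiv q hsimple i j
  -- `Φ_q = ∫ λ₁^q`, `T_q ≥ 0`
  have hΦ : torusTopEigMoment q v = ∫ x, torusStrainTopEig v x ^ q := by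
    rw [torusTopEigMoment_eq hv hdiv q]
    exact integral_congr_ae (ae_of_all _ fun x => by show lam _ ^ q = _; rw [lam_strainFlat])
  have hF0 : 0 ≤ torusTopEigMoment q v := torusTopEigMoment_nonneg q v
  set T : ℝ := heatDissipation (torusTopEigMoment q) v with hTdef
  have hT0 : 0 ≤ T :=
    heatDissipation_nonneg_of_admissible hq1 convexOn_lam lipschitzWith_lam
      (fun _ hv hdiv x => lam_strainFlat_nonneg hv hdiv x)
      (fun _ hv hdiv => torusTopEigMoment_eq hv hdiv q) hv hdiv
  -- the column density `ρ = λ₁^{q−2} · topColumnSq` and N14b with the uniform constant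
  set ρ : UnitAddTorus (Fin 3) → ℝ := fun x => torusStrainTopEig v x ^ (q - 2) * topColumnSq v x with hρdef
  have hρc : Continuous ρ := hLc.mul (continuous_topColumnSq hv hsimple)
  have hρx0 : ∀ x, 0 ≤ ρ x := fun x => mul_nonneg (Real.rpow_nonneg (hl0 x) _) (topColumnSq_nonneg v x)
  have hN14 : q * m * ∫ x, ρ x ≤ T :=
    heatDissipation_topEigMoment_ge_integral_column_min hq1 hv hdiv hsimple
  have hρle : ∫ x, ρ x ≤ 1 / (q * m) * T := by
    rw [div_mul_eq_mul_div, one_mul, le_div_iff₀ (mul_pos hq0 hm0)]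
    calc (∫ x, ρ x) * (q * m) = q * m * ∫ x, ρ x := by ring
      _ ≤ T := hN14
  -- GRADIENT SIDE, pointwise
  set c₁ : ℝ := 2 * ((q - 2) ^ 2 + 2 / η ^ 2) with hc₁
  have hc₁0 : 0 < c₁ := by positivity
  have hGle : ∀ x, ∑ k, ∑ i, ∑ j, (Torus.partialDeriv k
      (fun y => torusStrainTopEig v y ^ (q - 2) * (torusStrainTopEig v y * topProj v y i j)) x) ^ 2 ≤
      c₁ * torusStrainTopEig v x ^ (q - 2) * ρ x := fun x => by
    have h := sum_sq_partialDeriv_powProj_le_topColumnSq hv hdiv q hη0 hη1 (hsimple x) (hgap x)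
    have e : c₁ * (torusStrainTopEig v x ^ (q - 2)) ^ 2 * topColumnSq v x =
        c₁ * torusStrainTopEig v x ^ (q - 2) * ρ x := by simp only [hρdef]; ring
    rw [← e]; exact h
  -- MOMENT SIDE through the velocity
  have hIBP : ∫ x, ∑ i, ∑ j, torusStrainMatrix v x i j *
        (torusStrainTopEig v x ^ (q - 2) * (torusStrainTopEig v x * topProj v x i j)) =
      -∫ x, ∑ j, v x j * ∑ i, Torus.partialDeriv i
        (fun y => torusStrainTopEig v y ^ (q - 2) * (torusStrainTopEig v y * topProj v y i j)) x :=
    integral_sum_strain_mul_eq_neg hv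
      (N := fun i j y => torusStrainTopEig v y ^ (q - 2) * (torusStrainTopEig v y * topProj v y i j)) hMs
      (fun i j x => powProj_symm q v i j x)
  have hstep : ∫ x, torusStrainTopEig v x ^ q =
      -∫ x, ∑ j, v x j * ∑ i, Torus.partialDeriv i
        (fun y => torusStrainTopEig v y ^ (q - 2) * (torusStrainTopEig v y * topProj v y i j)) x := by
    rw [← hIBP]
    exact integral_congr_ae (ae_of_all _ fun x => (sum_strain_mul_powProj (hlpos x)).symm)
  -- pointwise: `|∑ⱼ vⱼ dⱼ| ≤ √(3c₁) ‖v‖ √(λ₁^{q−2}) √ρ`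
  have hpt : ∀ x, -(∑ j, v x j * ∑ i, Torus.partialDeriv i
      (fun y => torusStrainTopEig v y ^ (q - 2) * (torusStrainTopEig v y * topProj v y i j)) x) ≤
      Real.sqrt (3 * c₁) * ((‖v x‖ * Real.sqrt (torusStrainTopEig v x ^ (q - 2))) * Real.sqrt (ρ x)) := by
    intro x
    set D : Fin 3 → Fin 3 → ℝ := fun i j => Torus.partialDeriv i
      (fun y => torusStrainTopEig v y ^ (q - 2) * (torusStrainTopEig v y * topProj v y i j)) x with hDdef
    have h1 := abs_sum_mul_le_norm_mul_sqrt (v x) (fun j => ∑ i, D i j)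
    have h2 := sum_sq_sum_le_three_mul D
    have hdiag : ∑ i, ∑ j, D i j ^ 2 ≤ ∑ k, ∑ i, ∑ j, (Torus.partialDeriv k
        (fun y => torusStrainTopEig v y ^ (q - 2) * (torusStrainTopEig v y * topProj v y i j)) x) ^ 2 := by
      refine Finset.sum_le_sum fun i _ => ?_
      exact Finset.single_le_sum (f := fun i' => ∑ j, (Torus.partialDeriv i
        (fun y => torusStrainTopEig v y ^ (q - 2) * (torusStrainTopEig v y * topProj v y i' j)) x) ^ 2)
        (fun i' _ => Finset.sum_nonneg fun j _ => sq_nonneg _) (Finset.mem_univ i)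
    have h3 : ∑ i, ∑ j, D i j ^ 2 ≤ c₁ * torusStrainTopEig v x ^ (q - 2) * ρ x := hdiag.trans (hGle x)
    have h4 : ∑ j, (∑ i, D i j) ^ 2 ≤ 3 * c₁ * (torusStrainTopEig v x ^ (q - 2) * ρ x) :=
      calc ∑ j, (∑ i, D i j) ^ 2 ≤ 3 * ∑ i, ∑ j, D i j ^ 2 := h2
        _ ≤ 3 * (c₁ * torusStrainTopEig v x ^ (q - 2) * ρ x) := by linarith
        _ = 3 * c₁ * (torusStrainTopEig v x ^ (q - 2) * ρ x) := by ring
    have h5 : Real.sqrt (∑ j, (∑ i, D i j) ^ 2) ≤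
        Real.sqrt (3 * c₁) * (Real.sqrt (torusStrainTopEig v x ^ (q - 2)) * Real.sqrt (ρ x)) := by
      rw [← Real.sqrt_mul (Real.rpow_nonneg (hl0 x) _), ← Real.sqrt_mul (by positivity)]
      exact Real.sqrt_le_sqrt h4
    have h6 := (neg_le_abs _).trans (h1.trans (mul_le_mul_of_nonneg_left h5 (norm_nonneg _)))
    calc -(∑ j, v x j * ∑ i, D i j)
        ≤ ‖v x‖ * (Real.sqrt (3 * c₁) * (Real.sqrt (torusStrainTopEig v x ^ (q - 2)) * Real.sqrt (ρ x))) := h6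
      _ = Real.sqrt (3 * c₁) * ((‖v x‖ * Real.sqrt (torusStrainTopEig v x ^ (q - 2))) * Real.sqrt (ρ x)) := by
          ring
  -- integrate and Cauchy–Schwarz
  have hfc : Continuous fun x => ‖v x‖ * Real.sqrt (torusStrainTopEig v x ^ (q - 2)) :=
    hv.continuous.norm.mul hLc.sqrt
  have hInt1 : Integrable (fun x => ∑ j, v x j * ∑ i, Torus.partialDeriv i
      (fun y => torusStrainTopEig v y ^ (q - 2) * (torusStrainTopEig v y * topProj v y i j)) x) volume :=
    (continuous_finsetSum _ fun j _ => ((hv.apply j).continuous.mul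
      (continuous_finsetSum _ fun i _ => ((hMs i j).partialDeriv i).continuous))).integrable_unitAddTorus
  set f : UnitAddTorus (Fin 3) → ℝ := fun x => ‖v x‖ * Real.sqrt (torusStrainTopEig v x ^ (q - 2)) with hfdef
  set g : UnitAddTorus (Fin 3) → ℝ := fun x => Real.sqrt (ρ x) with hgdef
  have hgc : Continuous g := hρc.sqrt
  have hf0 : ∀ x, 0 ≤ f x := fun x => mul_nonneg (norm_nonneg _) (Real.sqrt_nonneg _)
  have hg0 : ∀ x, 0 ≤ g x := fun x => Real.sqrt_nonneg _
  have hf2 : ∀ x, f x ^ 2 = ‖v x‖ ^ 2 * torusStrainTopEig v x ^ (q - 2) := fun x => by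
    simp only [hfdef]; rw [mul_pow, Real.sq_sqrt (Real.rpow_nonneg (hl0 x) _)]
  have hg2 : ∀ x, g x ^ 2 = ρ x := fun x => Real.sq_sqrt (hρx0 x)
  have hfgint : Integrable (fun x => f x * g x) volume := (hfc.mul hgc).integrable_unitAddTorus
  have hM1 : ∫ x, torusStrainTopEig v x ^ q ≤ Real.sqrt (3 * c₁) * ∫ x, f x * g x := by
    rw [hstep, ← integral_neg, ← integral_const_mul]
    exact integral_mono hInt1.neg (hfgint.const_mul _) hpt
  have hfL : MemLp f (ENNReal.ofReal 2) volume :=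
    hfc.memLp_of_hasCompactSupport (HasCompactSupport.of_compactSpace _)
  have hgL : MemLp g (ENNReal.ofReal 2) volume :=
    hgc.memLp_of_hasCompactSupport (HasCompactSupport.of_compactSpace _)
  have hCS := integral_mul_le_Lp_mul_Lq_of_nonneg (μ := volume) Real.HolderConjugate.two_two
    (ae_of_all _ hf0) (ae_of_all _ hg0) hfL hgL
  have eF : ∫ x, f x ^ (2 : ℝ) = ∫ x, ‖v x‖ ^ 2 * torusStrainTopEig v x ^ (q - 2) :=
    integral_congr_ae (ae_of_all _ fun x => by dsimp only; rw [Real.rpow_two, hf2 x])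
  have eG : ∫ x, g x ^ (2 : ℝ) = ∫ x, ρ x :=
    integral_congr_ae (ae_of_all _ fun x => by dsimp only; rw [Real.rpow_two, hg2 x])
  rw [eF, eG, ← Real.sqrt_eq_rpow, ← Real.sqrt_eq_rpow] at hCS
  have hs1 : Real.sqrt (∫ x, ‖v x‖ ^ 2 * torusStrainTopEig v x ^ (q - 2)) ≤
      Real.sqrt (K * torusTopEigMoment q v) := Real.sqrt_le_sqrt hK
  have hs2 : Real.sqrt (∫ x, ρ x) ≤ Real.sqrt (1 / (q * m) * T) := Real.sqrt_le_sqrt hρle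
  have hM2 : ∫ x, f x * g x ≤ Real.sqrt (K * torusTopEigMoment q v) * Real.sqrt (1 / (q * m) * T) :=
    hCS.trans (mul_le_mul hs1 hs2 (Real.sqrt_nonneg _) (Real.sqrt_nonneg _))
  have hmain : torusTopEigMoment q v ≤
      Real.sqrt (3 * c₁) * (Real.sqrt (K * torusTopEigMoment q v) * Real.sqrt (1 / (q * m) * T)) :=
    calc torusTopEigMoment q v = ∫ x, torusStrainTopEig v x ^ q := hΦ
      _ ≤ Real.sqrt (3 * c₁) * ∫ x, f x * g x := hM1
      _ ≤ Real.sqrt (3 * c₁) * (Real.sqrt (K * torusTopEigMoment q v) * Real.sqrt (1 / (q * m) * T)) :=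
          mul_le_mul_of_nonneg_left hM2 (Real.sqrt_nonneg _)
  -- square: `Φ² ≤ 3c₁ · KΦ · T/(q m)`, hence `Φ ≤ (3c₁K/(q m)) T` when `Φ > 0`
  set F : ℝ := torusTopEigMoment q v with hFdef
  have hsq : F ^ 2 ≤ 3 * c₁ * (K * F * (1 / (q * m) * T)) := by
    have h := pow_le_pow_left₀ hF0 hmain 2
    rw [mul_pow, mul_pow, Real.sq_sqrt (by positivity), Real.sq_sqrt (by positivity),
      Real.sq_sqrt (by positivity)] at h
    exact h
  have hden : 0 < 3 * c₁ * (K + 1) := by positivity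
  rcases hF0.eq_or_lt with hF | hFpos
  · rw [← hF, mul_zero]; exact hT0
  · -- divide by `F > 0`
    have h1 : F ≤ 3 * c₁ * K / (q * m) * T := by
      have h2 : F * F ≤ F * (3 * c₁ * K / (q * m) * T) := by
        have e : 3 * c₁ * (K * F * (1 / (q * m) * T)) = F * (3 * c₁ * K / (q * m) * T) := by
          field_simp
        rw [← e, ← sq]; exact hsq
      exact le_of_mul_le_mul_left h2 hFpos
    have h3 : 3 * c₁ * K / (q * m) * T ≤ 3 * c₁ * (K + 1) / (q * m) * T := by
      apply mul_le_mul_of_nonneg_right _ hT0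
      apply div_le_div_of_nonneg_right _ (by positivity)
      nlinarith
    calc q * m / (3 * c₁ * (K + 1)) * F
        ≤ q * m / (3 * c₁ * (K + 1)) * (3 * c₁ * (K + 1) / (q * m) * T) :=
          mul_le_mul_of_nonneg_left (h1.trans h3) (by positivity)
      _ = T := by field_simp

/-! ## 2. The node on the amplitude-floor part of the gap class, `6/5 ≤ q ≤ 2` -/

/-- **PROPOSITION L-λ(η) BELOW `q = 2` ON THE AMPLITUDE-FLOOR PART OF THE TOP-GAP CLASS, `6/5 ≤ q ≤ 2`.**
For `6/5 ≤ q ≤ 2`, `0 < η ≤ 1` and `κ > 0` there is `c > 0` (`= q·min(q−1,2/3)·…·κ^{2−q}`, existential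
through the two embedding constants) such that `c·Φ_q(v) ≤ T_q(v)` for every smooth, divergence-free,
zero-mean `v` on `T³` with `λ₂ ≤ (1−η)λ₁` AND `κ·Φ_q(v)^{1/q} ≤ λ₁` at every point. The class is written
inline; no definition. For `5/3 ≤ q ≤ 2` this is `topEigHeatCoerciveOn_gap_floor` (same constant).
NOT the node `TopEigGapCoercivePos q η` (no floor). [ours] -/
theorem topEigHeatCoerciveOn_gap_floor_low {q η κ : ℝ} (hq : 6 / 5 ≤ q) (hq2 : q ≤ 2) (hη0 : 0 < η)
    (hη1 : η ≤ 1) (hκ : 0 < κ) :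
    ∃ c : ℝ, 0 < c ∧ HeatCoerciveOn (d := Fin 3)
      (fun v => StrainGapClass η v ∧ ∀ x, κ * torusTopEigMoment q v ^ (1 / q) ≤ torusStrainTopEig v x)
      (torusTopEigMoment q) c := by
  have hq0 : 0 < q := by linarith
  have hq1 : (1 : ℝ) < q := by linarith
  have hm0 : 0 < min (q - 1) (2 / 3) := lt_min (by linarith) (by norm_num)
  obtain ⟨K₀, hK₀0, hK₀⟩ := exists_integral_norm_sq_mul_topEig_rpow_le_of_floor (q := q) hq hq2
  set c₁ : ℝ := 2 * ((q - 2) ^ 2 + 2 / η ^ 2) with hc₁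
  have hc₁0 : 0 < c₁ := by positivity
  have hκq : 0 ≤ κ ^ (q - 2) := Real.rpow_nonneg hκ.le _
  refine ⟨q * min (q - 1) (2 / 3) / (3 * c₁ * (K₀ * κ ^ (q - 2) + 1)), by positivity, ?_⟩
  intro _ v hv hdiv hmean hP
  obtain ⟨hgap, hfloor⟩ := hP
  have hF0 : 0 ≤ torusTopEigMoment q v := torusTopEigMoment_nonneg q v
  rcases hF0.eq_or_lt with hF | hFpos
  · rw [← hF, mul_zero]
    exact heatDissipation_nonneg_of_admissible hq1.le convexOn_lam lipschitzWith_lam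
      (fun _ hv hdiv x => lam_strainFlat_nonneg hv hdiv x)
      (fun _ hv hdiv => torusTopEigMoment_eq hv hdiv q) hv hdiv
  · set m : ℝ := κ * torusTopEigMoment q v ^ (1 / q) with hmdef
    have hFq : 0 < torusTopEigMoment q v ^ (1 / q) := Real.rpow_pos_of_pos hFpos _
    have hm : 0 < m := mul_pos hκ hFq
    have hlpos : ∀ x, 0 < torusStrainTopEig v x := fun x => hm.trans_le (hfloor x)
    have hsimple : ∀ x, torusStrainMidEig v x < torusStrainTopEig v x := fun x => by
      have h := hgap x
      have : (1 - η) * torusStrainTopEig v x < torusStrainTopEig v x := by nlinarith [hlpos x]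
      exact lt_of_le_of_lt h this
    -- the brick with `m = κ Φ^{1/q}`: `K₀ m^{q−2} Φ^{2/q} = K₀ κ^{q−2} Φ`
    have hbrick := hK₀ v hv hdiv hmean m hm hfloor
    have e : K₀ * m ^ (q - 2) * torusTopEigMoment q v ^ (2 / q) =
        K₀ * κ ^ (q - 2) * torusTopEigMoment q v := by
      rw [hmdef, Real.mul_rpow hκ.le hFq.le, ← Real.rpow_mul hF0, mul_assoc, mul_assoc, mul_assoc,
        ← Real.rpow_add hFpos]
      congr 2
      rw [show 1 / q * (q - 2) + 2 / q = 1 by field_simp; ring, Real.rpow_one]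
    rw [e] at hbrick
    exact topEigMoment_rpow_le_heatDissipation_of_simple_gap_min hv hdiv hq1 hη0 hη1 hsimple hgap
      (mul_nonneg hK₀0 hκq) hbrick

/-- **Every `η > 0`, `6/5 ≤ q ≤ 2`** (larger `η` is a smaller class: for `η ≥ 1` the gap condition forces
`λ₂ ≤ 0 = (1−1)λ₁` since `λ₁ ≥ 0` on the floor class, so the `η = 1` statement applies).
[ours, bookkeeping] -/
theorem topEigHeatCoerciveOn_gap_floor_low' {q η κ : ℝ} (hq : 6 / 5 ≤ q) (hq2 : q ≤ 2) (hη0 : 0 < η)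
    (hκ : 0 < κ) :
    ∃ c : ℝ, 0 < c ∧ HeatCoerciveOn (d := Fin 3)
      (fun v => StrainGapClass η v ∧ ∀ x, κ * torusTopEigMoment q v ^ (1 / q) ≤ torusStrainTopEig v x)
      (torusTopEigMoment q) c := by
  rcases le_or_gt η 1 with h1 | h1
  · exact topEigHeatCoerciveOn_gap_floor_low hq hq2 hη0 h1 hκ
  · obtain ⟨c, hc, h⟩ := topEigHeatCoerciveOn_gap_floor_low (η := 1) hq hq2 one_pos le_rfl hκ
    refine ⟨c, hc, h.of_imp fun _ v _ _ _ hP => ?_⟩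
    obtain ⟨hgap, hfloor⟩ := hP
    refine ⟨fun x => ?_, hfloor⟩
    have hl0 : 0 ≤ torusStrainTopEig v x :=
      (mul_nonneg hκ.le (Real.rpow_nonneg (torusTopEigMoment_nonneg q v) _)).trans (hfloor x)
    have hg := hgap x
    nlinarith

end TopEig

end Summit.NavierStokesRegularity.FunctionalMining

end
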